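import Summits.ABC.ABC.Theorems.IneffectiveSubspaceDeepRegimeABCRidoutCoreBound
import Summits.ABC.ABC.Theorems.IneffectiveSubspaceDeepRegimeABCStubRoughReduction
import Summits.ABC.ABC.Theses.IneffectiveSubspace

/-!
# `DeepRegimeABC` (stmt-ABC-15121), line `SketchIdeator5R2`: the crux is equivalent to `RoughPowerfulTailABC`

Net result of the line (card `ridout-core-exhaustion`, crux-ideate r2 k5): with Ridout's theorem over `ℚ`
(landed: `Ridout.false_of_class_abs`, `Ridout.finite_of_abs_le_one_of_class`, `ridoutZeroInt_holds`,
`ridoutCoreBound_holds`) every CORED abc triple is bounded, and with the rough reduction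
(`stub_roughReduction`) the crux `DeepRegimeABC` is EQUIVALENT to the line's open stub
`RoughPowerfulTailABC`: abc with exponent `1+ε` on the deep tail `{ω₅(abc) ≥ K}` for triples whose
`y`-rough powerful excess `Σ_{p>y, p∣abc} (v_p(abc)−1)·log p` is `≥ θ·log c` (`0 < θ < ε/(1+ε)`;
`y, K, C` free) — the honest residue, on which no engine is claimed.

* `deepRegimeABC_of_roughPowerfulTail`, `roughPowerfulTail_of_deepRegimeABC`,
  `deepRegimeABC_iff_roughPowerfulTail`.

Deliberately NOT here: any claim about the open stub itself.
-/

-- `Summit.ABC.ABC…` is the mandated summit-side namespace (CONVENTIONS §2); the duplicate is deliberate.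
set_option linter.dupNamespace false

noncomputable section

namespace Summit.ABC.ABC.Theorems.DeepRegimeABC

open Literature.NumberTheory.DiophantineGeometry

/-- `rad(abc)^(1+ε) ≥ 1` for `ε > 0`. [folklore] -/
theorem one_le_rad_rpow' (a b c : ℕ) {ε : ℝ} (hε : 0 < ε) :
    (1 : ℝ) ≤ ((rad a b c : ℕ) : ℝ) ^ (1 + ε) := by
  have h1 : (1 : ℝ) ≤ ((rad a b c : ℕ) : ℝ) := by
    rw [rad_def]
    exact_mod_cast Nat.pos_of_ne_zero UniqueFactorizationMonoid.radical_ne_zero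
  exact Real.one_le_rpow h1 (by linarith)

/-- **The open stub implies the crux** (the line's composition, every other ingredient landed):
`RoughPowerfulTailABC → DeepRegimeABC`. Given `ε`, the rough reduction `stub_roughReduction` turns the
hypothesis into abc on CORELESS deep triples (`M_y < (2+δ) log c`) for some `y, δ, K, C`; the CORED
deep triples are bounded by `B(y, δ)` (`ridoutCoreBound_holds`) and absorbed into the constant
`max C (B+1)` since `rad^{1+ε} ≥ 1`. [folklore] -/
theorem deepRegimeABC_of_roughPowerfulTail
    (hT : ∀ ε : ℝ, 0 < ε → ∀ θ : ℝ, 0 < θ → θ * (1 + ε) < ε → ∃ y : ℕ, ∃ K : ℕ, ∃ C : ℝ, 0 < C ∧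
      ∀ a b c : ℕ, IsABCTriple a b c →
        K ≤ ((a * b * c).primeFactors.filter (fun p => 5 ≤ (a * b * c).factorization p)).card →
        θ * Real.log c ≤
          ∑ p ∈ (a * b * c).primeFactors.filter (fun p => ¬ p ≤ y),
            (((a * b * c).factorization p : ℝ) - 1) * Real.log p →
        (c : ℝ) < C * ((rad a b c : ℕ) : ℝ) ^ (1 + ε)) :
    Summit.ABC.ABC.Theses.IneffectiveSubspace.DeepRegimeABC := by
  intro ε hε
  obtain ⟨y, δ, hδ, K, C, hC0, h⟩ := stub_roughReduction hT ε hε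
  obtain ⟨B, hB⟩ := ridoutCoreBound_holds y δ hδ
  refine ⟨K, max C (B + 1), lt_max_of_lt_left hC0, fun a b c habc hK => ?_⟩
  have hrad1 : (1 : ℝ) ≤ ((rad a b c : ℕ) : ℝ) ^ (1 + ε) := one_le_rad_rpow' a b c hε
  have hrad0 : (0 : ℝ) ≤ ((rad a b c : ℕ) : ℝ) ^ (1 + ε) := le_trans zero_le_one hrad1
  have hmax0 : (0 : ℝ) ≤ max C (B + 1) := le_trans hC0.le (le_max_left _ _)
  by_cases hcore :
      (∑ p ∈ (a * b * c).primeFactors.filter (fun p => p ≤ y),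
            ((a * b * c).factorization p : ℝ) * Real.log p)
          + Real.log ((c : ℝ) / ((min a b : ℕ) : ℝ)) < (2 + δ) * Real.log c
  · calc (c : ℝ) < C * ((rad a b c : ℕ) : ℝ) ^ (1 + ε) := h a b c habc hK hcore
      _ ≤ max C (B + 1) * ((rad a b c : ℕ) : ℝ) ^ (1 + ε) :=
          mul_le_mul_of_nonneg_right (le_max_left _ _) hrad0
  · have hcB : (c : ℝ) ≤ B := hB a b c habc (not_lt.mp hcore)
    calc (c : ℝ) ≤ B := hcB
      _ < B + 1 := by linarith
      _ ≤ max C (B + 1) := le_max_right _ _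
      _ = max C (B + 1) * 1 := (mul_one _).symm
      _ ≤ max C (B + 1) * ((rad a b c : ℕ) : ℝ) ^ (1 + ε) :=
          mul_le_mul_of_nonneg_left hrad1 hmax0

/-- **The crux implies the open stub** (ignore the extra hypotheses; `y := 0`). [folklore] -/
theorem roughPowerfulTail_of_deepRegimeABC
    (h : Summit.ABC.ABC.Theses.IneffectiveSubspace.DeepRegimeABC) :
    ∀ ε : ℝ, 0 < ε → ∀ θ : ℝ, 0 < θ → θ * (1 + ε) < ε → ∃ y : ℕ, ∃ K : ℕ, ∃ C : ℝ, 0 < C ∧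
      ∀ a b c : ℕ, IsABCTriple a b c →
        K ≤ ((a * b * c).primeFactors.filter (fun p => 5 ≤ (a * b * c).factorization p)).card →
        θ * Real.log c ≤
          ∑ p ∈ (a * b * c).primeFactors.filter (fun p => ¬ p ≤ y),
            (((a * b * c).factorization p : ℝ) - 1) * Real.log p →
        (c : ℝ) < C * ((rad a b c : ℕ) : ℝ) ^ (1 + ε) := by
  intro ε hε θ _ _
  obtain ⟨K, C, hC, hK⟩ := h ε hε
  exact ⟨0, K, C, hC, fun a b c habc hKle _ => hK a b c habc hKle⟩

/-- **Line `SketchIdeator5R2`, net result: the crux `DeepRegimeABC` is EQUIVALENT to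
`RoughPowerfulTailABC`** — abc with exponent `1+ε` on the deep tail `{ω₅(abc) ≥ K}` for triples
whose `y`-rough powerful excess `Σ_{p>y, p∣abc}(v_p(abc)−1)·log p` is at least `θ·log c`
(`0 < θ < ε/(1+ε)`; `y, K, C` free). Ridout's theorem (landed: `Ridout.false_of_class_abs`,
`Ridout.finite_of_abs_le_one_of_class`, `ridoutCoreBound_holds`) removes every CORED configuration;
what is left is the rough-powerful residue, on which no engine is claimed. [folklore] -/
theorem deepRegimeABC_iff_roughPowerfulTail :
    Summit.ABC.ABC.Theses.IneffectiveSubspace.DeepRegimeABC ↔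
      (∀ ε : ℝ, 0 < ε → ∀ θ : ℝ, 0 < θ → θ * (1 + ε) < ε → ∃ y : ℕ, ∃ K : ℕ, ∃ C : ℝ, 0 < C ∧
        ∀ a b c : ℕ, IsABCTriple a b c →
          K ≤ ((a * b * c).primeFactors.filter (fun p => 5 ≤ (a * b * c).factorization p)).card →
          θ * Real.log c ≤
            ∑ p ∈ (a * b * c).primeFactors.filter (fun p => ¬ p ≤ y),
              (((a * b * c).factorization p : ℝ) - 1) * Real.log p →
          (c : ℝ) < C * ((rad a b c : ℕ) : ℝ) ^ (1 + ε)) :=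
  ⟨roughPowerfulTail_of_deepRegimeABC, deepRegimeABC_of_roughPowerfulTail⟩

end Summit.ABC.ABC.Theorems.DeepRegimeABC

end
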